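import Summits.CriticalPhenomena.SAWScalingLimit.Theorems.SAWDevelopingMapObservableToSLETypeLadderRotationSAW
import HarnessLib

/-!
# Stub H2 `stub_rotationGates` of line `six-class-type-ladder` (crux
`SAWDevelopingMap.ObservableToSLE`, stmt-CriticalPhenomena-10472): lattice-rotation transport of
the gate vocabulary

The line reduces carved-law identification for a CO-ORIENTED flat class `(j, j)` to the class
`(0, 0)` by rotating everything by `conj(ζ^j)` (`ζ = triZeta = e^{iπ/3}`).  Lattice side:
`T := σ^{-n} = (hexRotIso n).symm : hexGraph ≃g hexGraph` acts on face centres by the isometry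
`z ↦ conj(ζ^n) z` (`hexCenter_hexRotIso_symm`; `rot_meshPoint` of the sibling stub H1
`…TypeLadderRotationSAW`; `‖ζ^n‖ = 1`).  This file transports the gate vocabulary of the twin
line `bridge-gate-renewal` (`…GateDefs`, `…NestedGateDefs`, `…NestedLinkDefs`) along `T`:
`hexBall` (one face rotation PERMUTES the three absolute row differences, `rowCoord_hexRot60`;
induct on `n`); signed-row DIFFERENCES (`rowOf (k + n) (σ^n v) − rowOf (k + n) (σ^n w) =
rowOf k v − rowOf k w`, `rowOf_sub_hexRotIso`, from the shift table `rowOf_succ_hexRot60`: the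
clean-window class shifts by `n`, differences are kept); `TameNestedFamily` (isometry,
`SimpleGraph.induceHom`, unions of `≤ N` hexagons); `ExteriorAnchored` (`Walk.map`, infinite
image under an injection); `WideEscape` / `WideLink` (`Path.map`); `IsFirstExitFrom` (`List.map`
commutes with `take`/`drop`/`getLast?`/`head?`); `IsGoodGateN` (an `↔`) and `IsFirstGoodGateN`
(minimality pulled back through `T⁻¹ = σ^n`).  The metric transports are proved once for a unit
multiplier `u` and used with `u = conj(ζ^n)` (forward, `T`) and `u = ζ^n` (backward, `T⁻¹`).
References: H. Kesten, J. Math. Phys. 4 (1963) §4; H. Duminil-Copin, S. Smirnov, Ann. of Math.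
175 (2012) (arXiv:1007.0575) §2 (honeycomb = faces of `𝕋`, its `60°` symmetry).
-/

noncomputable section

open scoped Classical ComplexConjugate
open Set Metric
open Literature.Probability.LatticeModels (HexVertex hexGraph hexCenter triZeta)

namespace Summit.CriticalPhenomena.SAWScalingLimit.Theorems.ObservableToSLE.TypeLadder

open Summit.CriticalPhenomena.SAWScalingLimit.Theorems.ObservableToSLER.BridgeGate
open Summit.CriticalPhenomena.SAWScalingLimit.Theorems.ObservableToSLER.NestedGate

section UnitMul

variable {u : ℂ} (hu : ‖u‖ = 1)
include hu

/-- A unit multiplier is an isometry of `ℂ`. [folklore] -/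
theorem dist_unit_mul (x y : ℂ) : dist (u * x) (u * y) = dist x y := by
  rw [dist_eq_norm, dist_eq_norm, ← mul_sub, norm_mul, hu, one_mul]

/-- `u · (conj u · z) = z` for a unit `u`. [folklore] -/
theorem unit_mul_conj_mul (z : ℂ) : u * (conj u * z) = z := by
  rw [← mul_assoc, Complex.mul_conj, Complex.normSq_eq_norm_sq, hu, one_pow, Complex.ofReal_one,
    one_mul]

/-- Closed balls are carried into the rotated domain: if `closedBall a r ⊆ Ω` and `u Ω ⊆ Ω'` then
`closedBall (u a) r ⊆ Ω'`. [folklore] -/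
theorem closedBall_unit_mul_subset {Ω Ω' : Set ℂ} (hΩ : ∀ z ∈ Ω, u * z ∈ Ω') {a : ℂ} {r : ℝ}
    (h : closedBall a r ⊆ Ω) : closedBall (u * a) r ⊆ Ω' := by
  intro z hz
  have hz' : conj u * z ∈ closedBall a r := by
    rw [mem_closedBall] at hz ⊢
    rwa [← dist_unit_mul hu, unit_mul_conj_mul hu]
  have h' := hΩ _ (h hz')
  rwa [unit_mul_conj_mul hu] at h'

/-- **Transport of clean flat windows** along a surjection `T` of vertices over the plane rotation
`z ↦ u z` carrying `S` onto `S'` and permuting signed-row differences. [folklore] -/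
theorem hasCleanWindow_transport {Ω Ω' : Set ℂ} {δ ρ : ℝ} {S S' : Set HexVertex} {p q : HexVertex}
    (T : HexVertex → HexVertex) (hT : Function.Surjective T) (hΩ : ∀ z ∈ Ω, u * z ∈ Ω')
    (hTc : ∀ v, (δ : ℂ) * hexCenter (T v) = u * ((δ : ℂ) * hexCenter v))
    (hS : ∀ v, T v ∈ S' ↔ v ∈ S)
    (hrow : ∀ k : Fin 6, ∃ k' : Fin 6, ∀ v w : HexVertex,
      rowOf k' (T v) - rowOf k' (T w) = rowOf k v - rowOf k w)
    (h : HasCleanWindow Ω δ ρ S p q) : HasCleanWindow Ω' δ ρ S' (T p) (T q) := by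
  obtain ⟨hball, k, hk, hwin⟩ := h
  obtain ⟨k', hk'⟩ := hrow k
  refine ⟨?_, k', ?_, fun x' hx' => ?_⟩
  · rw [hTc]
    exact closedBall_unit_mul_subset hu hΩ hball
  · have e := hk' q p
    omega
  · obtain ⟨x, rfl⟩ := hT x'
    rw [hTc, hTc, mem_ball, dist_unit_mul hu, ← mem_ball] at hx'
    rw [hS, hwin x hx']
    have e := hk' x p
    constructor <;> (intro hle; omega)

/-- **Transport of wide escapes** over the plane rotation `z ↦ u z` (`Path.map`). [folklore] -/
theorem wideEscape_transport {Ω Ω' : Set ℂ} {δ ρ R : ℝ} {S S' : Set HexVertex}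
    {c q c' q' : HexVertex} (hΩ : ∀ z ∈ Ω, u * z ∈ Ω')
    (hS : ∀ v' ∈ S', ∃ v ∈ S, (δ : ℂ) * hexCenter v' = u * ((δ : ℂ) * hexCenter v))
    (hc : (δ : ℂ) * hexCenter c' = u * ((δ : ℂ) * hexCenter c))
    (hq : (δ : ℂ) * hexCenter q' = u * ((δ : ℂ) * hexCenter q))
    (h : WideEscape Ω δ ρ R S c q) : WideEscape Ω' δ ρ R S' c' q' := by
  obtain ⟨x, y, γ, hx, hy, hγ⟩ := h
  refine ⟨u * x, u * y, γ.map (continuous_const_mul u), ?_, ?_, fun t => ⟨?_, fun v' hv' => ?_⟩⟩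
  · rwa [hq, dist_unit_mul hu]
  · rwa [hc, dist_unit_mul hu]
  · exact closedBall_unit_mul_subset hu hΩ (hγ t).1
  · obtain ⟨v, hv, e⟩ := hS v' hv'
    rw [e]
    show ρ / 4 ≤ dist (u * γ t) _
    rw [dist_unit_mul hu]
    exact (hγ t).2 v hv

/-- **Transport of wide links** over the plane rotation `z ↦ u z` (`Path.map`). [folklore] -/
theorem wideLink_transport {Ω Ω' : Set ℂ} {δ ρ : ℝ} {U U' : Set HexVertex}
    {q q' r r' : HexVertex} (hΩ : ∀ z ∈ Ω, u * z ∈ Ω')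
    (hU : ∀ v' ∈ U', ∃ v ∈ U, (δ : ℂ) * hexCenter v' = u * ((δ : ℂ) * hexCenter v))
    (hq : (δ : ℂ) * hexCenter r = u * ((δ : ℂ) * hexCenter q))
    (hq' : (δ : ℂ) * hexCenter r' = u * ((δ : ℂ) * hexCenter q'))
    (h : WideLink Ω δ ρ U q q') : WideLink Ω' δ ρ U' r r' := by
  obtain ⟨x, x', γ, hx, hx', hγ⟩ := h
  refine ⟨u * x, u * x', γ.map (continuous_const_mul u), ?_, ?_, fun t => ⟨?_, fun v' hv' => ?_⟩⟩
  · rwa [hq, dist_unit_mul hu]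
  · rwa [hq', dist_unit_mul hu]
  · exact closedBall_unit_mul_subset hu hΩ (hγ t).1
  · obtain ⟨v, hv, e⟩ := hU v' hv'
    rw [e]
    show ρ / 4 ≤ dist (u * γ t) _
    rw [dist_unit_mul hu]
    exact (hγ t).2 v hv

end UnitMul

/-- **First exits commute with an injective relabelling of vertices** (`List.map` commutes with
`take`, `drop`, `getLast?`, `head?`). [folklore] -/
theorem isFirstExitFrom_map_iff {S : Set HexVertex} {l : List HexVertex} {m : ℕ} {p q : HexVertex}
    {T : HexVertex → HexVertex} (hT : Function.Injective T) :
    IsFirstExitFrom (T '' S) (l.map T) m (T p) (T q) ↔ IsFirstExitFrom S l m p q := by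
  simp only [IsFirstExitFrom, ← List.map_take, ← List.map_drop, List.getLast?_map, List.head?_map,
    Option.map_eq_some_iff, hT.eq_iff, exists_eq_right, List.forall_mem_map, hT.mem_set_image]

/-! ### The face rotation on lattice hexagons and signed rows -/

/-- One face rotation permutes the unsigned row coordinates (up to sign and a unit shift):
`(r₀, r₁, r₂)(σ v) = (r₂ v, −r₀ v − 1, r₁ v)`. -/
theorem rowCoord_hexRot60 (v : HexVertex) :
    rowCoord 0 (hexRot60 v) = rowCoord 2 v ∧ rowCoord 1 (hexRot60 v) = -rowCoord 0 v - 1 ∧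
      rowCoord 2 (hexRot60 v) = rowCoord 1 v := by
  obtain ⟨x, t⟩ := v
  fin_cases t <;> simp [rowCoord, hexRot60]
  omega

/-- Membership in a lattice hexagon, coordinatewise. -/
theorem mem_hexBall_iff (c : HexVertex) (n : ℕ) (v : HexVertex) :
    v ∈ hexBall c n ↔ |rowCoord 0 v - rowCoord 0 c| ≤ n ∧ |rowCoord 1 v - rowCoord 1 c| ≤ n ∧
      |rowCoord 2 v - rowCoord 2 c| ≤ n :=
  ⟨fun h => ⟨h 0, h 1, h 2⟩, fun ⟨h0, h1, h2⟩ i => by fin_cases i <;> assumption⟩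

/-- **One face rotation maps lattice hexagons to lattice hexagons:** `σ v ∈ hexBall (σ c) n ↔
v ∈ hexBall c n` (the three absolute row differences are permuted). -/
theorem hexRot60_mem_hexBall_iff (c : HexVertex) (n : ℕ) (v : HexVertex) :
    hexRot60 v ∈ hexBall (hexRot60 c) n ↔ v ∈ hexBall c n := by
  obtain ⟨h0, h1, h2⟩ := rowCoord_hexRot60 v
  obtain ⟨g0, g1, g2⟩ := rowCoord_hexRot60 c
  rw [mem_hexBall_iff, mem_hexBall_iff, h0, h1, h2, g0, g1, g2,
    show -rowCoord 0 v - 1 - (-rowCoord 0 c - 1) = -(rowCoord 0 v - rowCoord 0 c) by ring, abs_neg]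
  tauto

/-- Iterated: `σ^m v ∈ hexBall (σ^m c) n ↔ v ∈ hexBall c n`. -/
theorem hexRotIso_mem_hexBall_iff (m : ℕ) (c : HexVertex) (n : ℕ) (v : HexVertex) :
    hexRotIso m v ∈ hexBall (hexRotIso m c) n ↔ v ∈ hexBall c n := by
  induction m with
  | zero => rw [hexRotIso_zero_apply, hexRotIso_zero_apply]
  | succ m ih => rw [hexRotIso_succ_apply, hexRotIso_succ_apply, hexRot60_mem_hexBall_iff, ih]

/-- Membership in a `σ^{-n}`-image, through `σ^n`. -/
theorem mem_image_rot_iff (n : ℕ) (A : Set HexVertex) (v : HexVertex) :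
    v ∈ ⇑(hexRotIso n).symm '' A ↔ hexRotIso n v ∈ A := by
  constructor
  · rintro ⟨w, hw, rfl⟩
    rwa [RelIso.apply_symm_apply]
  · intro h
    exact ⟨_, h, RelIso.symm_apply_apply _ _⟩

/-- **Clause 1: lattice hexagons are rotated to lattice hexagons,**
`σ^{-n} (hexBall t k) = hexBall (σ^{-n} t) k`. -/
theorem image_hexBall_rot (n : ℕ) (t : HexVertex) (k : ℕ) :
    ⇑(hexRotIso n).symm '' hexBall t k = hexBall ((hexRotIso n).symm t) k := by
  ext w
  rw [mem_image_rot_iff, ← hexRotIso_mem_hexBall_iff n ((hexRotIso n).symm t) k w,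
    RelIso.apply_symm_apply]

/-- **Signed-row differences under `σ^n`:** the class shifts by `n`, differences are preserved:
`rowOf (k + n) (σ^n v) − rowOf (k + n) (σ^n w) = rowOf k v − rowOf k w`. -/
theorem rowOf_sub_hexRotIso (n : ℕ) (k : Fin 6) (v w : HexVertex) :
    rowOf (k + n • (1 : Fin 6)) (hexRotIso n v) - rowOf (k + n • (1 : Fin 6)) (hexRotIso n w) =
      rowOf k v - rowOf k w := by
  induction n with
  | zero => simp
  | succ n ih =>
    rw [succ_nsmul, ← add_assoc, hexRotIso_succ_apply, hexRotIso_succ_apply, rowOf_succ_hexRot60,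
      rowOf_succ_hexRot60, ← ih]
    ring

/-- **Clause 2: the class-`j` row difference is the class-`0` row difference after rotating back
by `σ^{-j}`** (`rowOf_hexRotIso`: `rowOf j (σ^j u) = rowOf 0 u + c_j`). -/
theorem rowOf_sub_eq_rowOf_zero_rot (n : ℕ) (j : Fin 6) (v w : HexVertex) (hj : (j : ℕ) = n) :
    rowOf j v - rowOf j w = rowOf 0 ((hexRotIso n).symm v) - rowOf 0 ((hexRotIso n).symm w) := by
  subst hj
  have hv := rowOf_hexRotIso j ((hexRotIso (j : ℕ)).symm v)
  have hw := rowOf_hexRotIso j ((hexRotIso (j : ℕ)).symm w)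
  rw [RelIso.apply_symm_apply] at hv hw
  rw [hv, hw]
  ring

/-! ### The rotation `σ^{-n}` over `z ↦ conj(ζ^n) z` -/

section Rotation

variable (n : ℕ) (Ω : Set ℂ) (δ : ℝ)

/-- `‖conj(ζ^n)‖ = 1`. -/
theorem norm_conj_triZeta_pow : ‖conj (triZeta ^ n)‖ = 1 := by
  rw [Complex.norm_conj, norm_triZeta_pow]

/-- `ζ^n · (conj(ζ^n) · z) = z`. -/
theorem triZeta_pow_mul_conj_mul (z : ℂ) : triZeta ^ n * (conj (triZeta ^ n) * z) = z := by
  rw [← mul_assoc, triZeta_pow_mul_conj_self, one_mul]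

/-- Mesh points rotated back: `δ c(v) = ζ^n · (δ c(σ^{-n} v))` (cf. `rot_meshPoint`). -/
theorem smul_hexCenter_eq_triZeta_pow_mul_rot (v : HexVertex) :
    (δ : ℂ) * hexCenter v = triZeta ^ n * ((δ : ℂ) * hexCenter ((hexRotIso n).symm v)) := by
  rw [rot_meshPoint, triZeta_pow_mul_conj_mul]

/-- The rotated domain is mapped back onto `Ω` by `z ↦ ζ^n z`. -/
theorem triZeta_pow_mul_mem_of_mem_image (z : ℂ)
    (hz : z ∈ (fun z : ℂ => conj (triZeta ^ n) * z) '' Ω) : triZeta ^ n * z ∈ Ω := by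
  obtain ⟨z, hz, rfl⟩ := hz
  rwa [triZeta_pow_mul_conj_mul]

/-- **Clause 3: tame nested gate families are rotated to tame nested gate families** (isometry,
induced-subgraph preconnectedness under the automorphism, unions of `≤ N` rotated hexagons). -/
theorem tameNestedFamily_rot (R : ℝ) (N : ℕ) (c : HexVertex) (S : ℕ → Set HexVertex)
    (h : TameNestedFamily δ R N c S) :
    TameNestedFamily δ R N ((hexRotIso n).symm c) (fun i => ⇑(hexRotIso n).symm '' S i) := by
  obtain ⟨hnest, hroot, hdist, hconn, hcover⟩ := h
  refine ⟨fun i => image_mono (hnest i), fun i => mem_image_of_mem _ (hroot i), ?_, ?_, ?_⟩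
  · rintro i _ ⟨v, hv, rfl⟩
    rw [rot_meshPoint, rot_meshPoint, dist_unit_mul (norm_conj_triZeta_pow n)]
    exact hdist i v hv
  · intro i
    have hmaps : Set.MapsTo (hexRotIso n).symm.toHom (S i) (⇑(hexRotIso n).symm '' S i) :=
      fun v hv => mem_image_of_mem _ hv
    refine (hconn i).map (SimpleGraph.induceHom (hexRotIso n).symm.toHom hmaps) ?_
    rintro ⟨_, v, hv, rfl⟩
    exact ⟨⟨v, hv⟩, rfl⟩
  · intro i
    obtain ⟨L, hL, hmem⟩ := hcover i
    refine ⟨L.map fun tk => ((hexRotIso n).symm tk.1, tk.2), by rwa [List.length_map], fun v => ?_⟩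
    rw [mem_image_rot_iff, hmem]
    constructor
    · rintro ⟨tk, htk, hv⟩
      refine ⟨((hexRotIso n).symm tk.1, tk.2), List.mem_map.2 ⟨tk, htk, rfl⟩, ?_⟩
      rwa [← image_hexBall_rot, mem_image_rot_iff]
    · rintro ⟨tk', htk', hv⟩
      obtain ⟨tk, htk, rfl⟩ := List.mem_map.1 htk'
      refine ⟨tk, htk, ?_⟩
      rwa [← image_hexBall_rot, mem_image_rot_iff] at hv

/-- **Clause 4: exterior anchoring is rotated** (walks are mapped by the automorphism; the image
of an infinite vertex set under the injection `σ^{-n}` is infinite). -/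
theorem exteriorAnchored_rot (U : Set HexVertex) (c : HexVertex) (h : ExteriorAnchored Ω δ U c) :
    ExteriorAnchored ((fun z : ℂ => conj (triZeta ^ n) * z) '' Ω) δ (⇑(hexRotIso n).symm '' U)
      ((hexRotIso n).symm c) := by
  unfold ExteriorAnchored at h ⊢
  refine infinite_of_injOn_mapsTo (f := ⇑(hexRotIso n).symm) (hexRotIso n).symm.injective.injOn
    ?_ h
  rintro z ⟨w, hw⟩
  refine ⟨w.map (hexRotIso n).symm.toHom, fun y hy => ?_⟩
  rw [SimpleGraph.Walk.support_map, List.mem_map] at hy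
  obtain ⟨x, hx, rfl⟩ := hy
  rcases hw x hx with h1 | h1
  · exact Or.inl (mem_image_of_mem _ h1)
  · right
    show (δ : ℂ) * hexCenter ((hexRotIso n).symm x) ∉ _
    rwa [rot_meshPoint, (mul_right_injective₀ (left_ne_zero_of_mul_eq_one
      (conj_triZeta_pow_mul_self n))).mem_set_image]

/-- **Clause 5: clean flat windows are rotated to clean flat windows, and back** (the class `k`
shifts by `n`, the signed-row differences and all distances are preserved). -/
theorem hasCleanWindow_rot_iff (ρ : ℝ) (S : Set HexVertex) (p q : HexVertex) :
    HasCleanWindow Ω δ ρ S p q ↔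
      HasCleanWindow ((fun z : ℂ => conj (triZeta ^ n) * z) '' Ω) δ ρ (⇑(hexRotIso n).symm '' S)
        ((hexRotIso n).symm p) ((hexRotIso n).symm q) := by
  constructor
  · intro h
    exact hasCleanWindow_transport (norm_conj_triZeta_pow n) _ (hexRotIso n).symm.surjective
      (fun z hz => mem_image_of_mem _ hz) (rot_meshPoint n δ)
      (fun v => (hexRotIso n).symm.injective.mem_set_image)
      (fun k => ⟨k - n • (1 : Fin 6), fun v w => by
        simpa only [RelIso.apply_symm_apply, sub_add_cancel] using (rowOf_sub_hexRotIso n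
          (k - n • (1 : Fin 6)) ((hexRotIso n).symm v) ((hexRotIso n).symm w)).symm⟩) h
  · intro h
    have h' := hasCleanWindow_transport (Ω' := Ω) (S' := S) (norm_triZeta_pow n) (hexRotIso n)
      (hexRotIso n).surjective (triZeta_pow_mul_mem_of_mem_image n Ω)
      (fun v => by rw [hexCenter_hexRotIso, mul_left_comm])
      (fun v => (mem_image_rot_iff n S v).symm)
      (fun k => ⟨k + n • (1 : Fin 6), rowOf_sub_hexRotIso n k⟩) h
    rwa [RelIso.apply_symm_apply, RelIso.apply_symm_apply] at h'

/-- Wide escapes are rotated to wide escapes, and back. -/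
theorem wideEscape_rot_iff (ρ R : ℝ) (S : Set HexVertex) (c q : HexVertex) :
    WideEscape ((fun z : ℂ => conj (triZeta ^ n) * z) '' Ω) δ ρ R (⇑(hexRotIso n).symm '' S)
        ((hexRotIso n).symm c) ((hexRotIso n).symm q) ↔ WideEscape Ω δ ρ R S c q := by
  constructor
  · intro h
    refine wideEscape_transport (norm_triZeta_pow n) (triZeta_pow_mul_mem_of_mem_image n Ω)
      (fun v hv => ?_) (smul_hexCenter_eq_triZeta_pow_mul_rot n δ c)
      (smul_hexCenter_eq_triZeta_pow_mul_rot n δ q) h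
    exact ⟨_, mem_image_of_mem _ hv, smul_hexCenter_eq_triZeta_pow_mul_rot n δ v⟩
  · intro h
    refine wideEscape_transport (norm_conj_triZeta_pow n) (fun z hz => mem_image_of_mem _ hz)
      ?_ (rot_meshPoint n δ c) (rot_meshPoint n δ q) h
    rintro _ ⟨v, hv, rfl⟩
    exact ⟨v, hv, rot_meshPoint n δ v⟩

/-- **Clause 6: wide links are rotated to wide links.** -/
theorem wideLink_rot (ρ : ℝ) (U : Set HexVertex) (q q' : HexVertex) (h : WideLink Ω δ ρ U q q') :
    WideLink ((fun z : ℂ => conj (triZeta ^ n) * z) '' Ω) δ ρ (⇑(hexRotIso n).symm '' U)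
      ((hexRotIso n).symm q) ((hexRotIso n).symm q') := by
  refine wideLink_transport (norm_conj_triZeta_pow n) (fun z hz => mem_image_of_mem _ hz)
    ?_ (rot_meshPoint n δ q) (rot_meshPoint n δ q') h
  rintro _ ⟨v, hv, rfl⟩
  exact ⟨v, hv, rot_meshPoint n δ v⟩

/-- **Good gates correspond under the rotation** (first exit, no return, clean window, wide
escape — each an `↔`). -/
theorem isGoodGateN_rot_iff (ρ R : ℝ) (S : ℕ → Set HexVertex) (c : HexVertex) (l : List HexVertex)
    (i m : ℕ) (p q : HexVertex) :
    IsGoodGateN ((fun z : ℂ => conj (triZeta ^ n) * z) '' Ω) δ ρ R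
        (fun i => ⇑(hexRotIso n).symm '' S i) ((hexRotIso n).symm c) (l.map ⇑(hexRotIso n).symm)
        i m ((hexRotIso n).symm p) ((hexRotIso n).symm q) ↔
      IsGoodGateN Ω δ ρ R S c l i m p q := by
  simp only [IsGoodGateN, isFirstExitFrom_map_iff (hexRotIso n).symm.injective,
    ← hasCleanWindow_rot_iff, wideEscape_rot_iff, ← List.map_drop, List.forall_mem_map,
    (hexRotIso n).symm.injective.mem_set_image]

/-- **Clause 7: first good gates are rotated to first good gates** (minimality over all good gates
of the rotated data, pulled back through `σ^n`). -/
theorem isFirstGoodGateN_rot (ρ R : ℝ) (S : ℕ → Set HexVertex) (c : HexVertex)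
    (l : List HexVertex) (i m : ℕ) (p q : HexVertex) (h : IsFirstGoodGateN Ω δ ρ R S c l i m p q) :
    IsFirstGoodGateN ((fun z : ℂ => conj (triZeta ^ n) * z) '' Ω) δ ρ R
      (fun i => ⇑(hexRotIso n).symm '' S i) ((hexRotIso n).symm c) (l.map ⇑(hexRotIso n).symm)
      i m ((hexRotIso n).symm p) ((hexRotIso n).symm q) := by
  refine ⟨(isGoodGateN_rot_iff n Ω δ ρ R S c l i m p q).2 h.1, fun n' m' p' q' h' => ?_⟩
  rw [← RelIso.symm_apply_apply (hexRotIso n) p', ← RelIso.symm_apply_apply (hexRotIso n) q',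
    isGoodGateN_rot_iff] at h'
  exact h.2 n' m' _ _ h'

end Rotation

/-- **H2 `stub_rotationGates` — lattice-rotation transport of the gate vocabulary.**  For every
`n`, the lattice rotation `T = σ^{-n} = (hexRotIso n).symm` (acting on face centres by
`z ↦ conj(ζ^n) z`) maps lattice hexagons to lattice hexagons, turns class-`j` signed-row
differences into class-`0` ones (`j = n`), and transports tame nested gate families, exterior
anchoring, clean flat windows (an `↔`), wide links and first good gates to their counterparts
for the rotated domain `conj(ζ^n) Ω`, the rotated vertex sets `T S` and the rotated list `l.map T`.
[folklore] -/
theorem stub_rotationGates :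
    ∀ (n : ℕ),
      (∀ (t : HexVertex) (k : ℕ), ⇑(hexRotIso n).symm '' hexBall t k = hexBall ((hexRotIso n).symm t) k) ∧
      (∀ (j : Fin 6) (v w : HexVertex), (j : ℕ) = n →
        rowOf j v - rowOf j w = rowOf 0 ((hexRotIso n).symm v) - rowOf 0 ((hexRotIso n).symm w)) ∧
      (∀ (δ R : ℝ) (N : ℕ) (c : HexVertex) (S : ℕ → Set HexVertex),
        TameNestedFamily δ R N c S →
          TameNestedFamily δ R N ((hexRotIso n).symm c) (fun i => ⇑(hexRotIso n).symm '' S i)) ∧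
      (∀ (Ω : Set ℂ) (δ : ℝ) (U : Set HexVertex) (c : HexVertex),
        ExteriorAnchored Ω δ U c →
          ExteriorAnchored ((fun z : ℂ => (starRingEnd ℂ) (triZeta ^ n) * z) '' Ω) δ
            (⇑(hexRotIso n).symm '' U) ((hexRotIso n).symm c)) ∧
      (∀ (Ω : Set ℂ) (δ ρ : ℝ) (S : Set HexVertex) (p q : HexVertex),
        HasCleanWindow Ω δ ρ S p q ↔
          HasCleanWindow ((fun z : ℂ => (starRingEnd ℂ) (triZeta ^ n) * z) '' Ω) δ ρ
            (⇑(hexRotIso n).symm '' S) ((hexRotIso n).symm p) ((hexRotIso n).symm q)) ∧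
      (∀ (Ω : Set ℂ) (δ ρ : ℝ) (U : Set HexVertex) (q q' : HexVertex),
        WideLink Ω δ ρ U q q' →
          WideLink ((fun z : ℂ => (starRingEnd ℂ) (triZeta ^ n) * z) '' Ω) δ ρ
            (⇑(hexRotIso n).symm '' U) ((hexRotIso n).symm q) ((hexRotIso n).symm q')) ∧
      (∀ (Ω : Set ℂ) (δ ρ R : ℝ) (S : ℕ → Set HexVertex) (c : HexVertex) (l : List HexVertex)
        (i m : ℕ) (p q : HexVertex),
        IsFirstGoodGateN Ω δ ρ R S c l i m p q →
          IsFirstGoodGateN ((fun z : ℂ => (starRingEnd ℂ) (triZeta ^ n) * z) '' Ω) δ ρ R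
            (fun i => ⇑(hexRotIso n).symm '' S i) ((hexRotIso n).symm c)
            (l.map ⇑(hexRotIso n).symm) i m ((hexRotIso n).symm p) ((hexRotIso n).symm q)) :=
  fun n => ⟨image_hexBall_rot n, fun j v w hj => rowOf_sub_eq_rowOf_zero_rot n j v w hj,
    fun δ R N c S => tameNestedFamily_rot n δ R N c S, fun Ω δ => exteriorAnchored_rot n Ω δ,
    fun Ω δ => hasCleanWindow_rot_iff n Ω δ, fun Ω δ => wideLink_rot n Ω δ,
    fun Ω δ => isFirstGoodGateN_rot n Ω δ⟩

end Summit.CriticalPhenomena.SAWScalingLimit.Theorems.ObservableToSLE.TypeLadder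

end
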